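import Literature.MathematicalPhysics.QuantumFieldTheory.Balaban1983to89.Node00.Record12BgRowReduction
import Literature.MathematicalPhysics.QuantumFieldTheory.Balaban1983to89.Node00.Record12ResidualsBg
import Literature.MathematicalPhysics.QuantumFieldTheory.Balaban1983to89.Node00.BgProvisoRangedOfRecord

/-!
# NODE 00 — ROW P11 of the Record13 gate, RANGED (`BgProvisoΛ`): the background of record lies in `U^c_j(X, α_{0,j}, α_{1,j})` (`X ⊂ Λ_j`) and in `Ũ^c_j(X)` —
# the PLAQUETTE HALF from [15] Theorem 1 (a named fact, per-scale reading) + the letter inequalities «proper restrictions on ε_j» in kernel; the GAUGE HALF displayed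

Cell `pub-ymgap`, seat `pub-ymgap-node00-def-P11` (R218 ∕ OPS-NOTE-16; director-ym №131–№132, dag-lead WORDS-123∕131: the POSITIVE supplier of row P11 on the ranged token
`BgProvisoΛ` of node00-def-R's FILE 20′ `Node00/BgProvisoRangedOfRecord`).  [III] = [Balaban1988Convergent]; [I] = [Balaban1987RG1]; [15] = T. Bałaban, *The variational problem
and background fields in renormalization group method for lattice gauge theories*, Commun. Math. Phys. **102** (1985) 277–309 [Balaban1985Variational]; [6] = [Balaban1985RegularSpaces].

HONEST FRAMING.  Bookkeeping + elementary real inequalities around ONE NAMED FACT (`VariationalThm1Scaled`, a `Prop` with print's constants as parameters — NEVER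
asserted, used as a hypothesis `(h15 : …)`), typed at def-R's objects of record; NOTHING of Bałaban is asserted or discharged; the two local-gauge clauses ((1.12) [I],
(2.38) [III]) stay DISPLAYED hypotheses with their locator ([15] Thm 1 (9)–(10)); K0′∕K0″ NOT closed; counts unmoved (typed 28∕28 · discharged 5∕28); one finite `𝕋⁴`
torus family at fixed `ε = L^{−K}`; not continuum ∕ OS ∕ mass gap ∕ Clay.  No `instance`, no `notation`, no `sorry`; two `def`s (the named fact in two readings).

THE ROW (after the re-point).  `BgProvisoΛ F N K S Rz M k Supp U` (def-R FILE 20′): for every (2.18) index `s`, retained `𝐖 ∈ Supp s`, scale `1 ≤ j ≤ k`, domain `X ∈ 𝐃_j`: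
(I) `domSites X ⊆ Λ_j(s)` ⇒ `(ι∘U(s,𝐖), 0) ∈ U^c_j(X, α₀(g_j), α₁(g_j))` of record; (MS) `X` in the (2.41) range (`admB … = true`) ⇒ `∈ Ũ^c_j(X)` of record.  At the K0′∕K0″
witnesses: `Supp = regSuppOfRecord … cR` (data `|∂𝐖_n − 1| < cR·ε_n(g_n)` on the plaquettes touching `Γ_n(s)`, `ε_n = g_n A₀ (log g_n⁻²)^{p₀}` (2.4)), `U = UbgMSOfRecord`
(the CHOSEN minimiser of (2.12) in print's class `U_k({Ω_j(s)}, εreg)` where one exists, `1` otherwise), `Rz = Residual.unit` (node00-def-K0b's `RzOfRecord`), `S.ι = ιSU N`.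

WHAT MEMBERSHIP COSTS (node00-def-K0b `Record12ResidualsBg`, by name): `U^c_j` at the unit recipe ⟸ [I] condition (i) for `ι∘U` = «`G`-valued» (free) ∧ «`|∂U − 1| < α₀ξ²`
on the plaquettes inside `X`» ∧ «(1.12): on every `O(1)LM`-cube of `X` a `G`-valued gauge `u` with `U^u = exp iξA`, `|A|, |∇^ξA| < O(1)LMB·α₀`» (`ofBackgroundC_mem_spaceI_unit_of_condI`);
`Ũ^c_j` ⟸ (2.34) on the layers `X ∩ (Ω_n ∖ Ω_{n+1})` ∧ (2.38) layer-cube gauges (`ofBackgroundC_mem_spaceMS_unit_of_conds`).  THIS FILE supplies the two PLAQUETTE clauses from the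
named fact and the numerics, and threads the two GAUGE clauses through as displayed hypotheses.

THE NAMED FACT AND THE LOCATED NUMERICS FINDING (the analysis pen's content).  [15] Thm 1 p. 279: for data `V` with «|∂V(p′) − 1| < ε₁ for p′ ⊂ 𝔅 (7)», `ε₁ ≤ a₁`,
«there exists a minimal orbit in the space U_k({Ω_j}, B₃ε₁) ∩ 𝔘(𝔅_k, V) (8). This orbit is a unique critical orbit in the space (6) [class ε₀] if B₃ε₁ ≤ ε₀ and ε₀ ≤ a₀»,
`U_k({Ω_j}, α) = {U | |U(∂p) − 1| < α·L^{−2j} on Ω_j}` ([6] (1.7)); so every minimiser in the class `ε₀` lies in the class `B₃ε₁` — the plaquette bound `B₃ε₁·η_j²` on `Ω_j ⊇ Λ_j ⊇ X`.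
(a) WITH PRINT'S UNIFORM `ε₁` (`VariationalThm1Class`, §2) the data of record force `ε₁ ≥ cR·max_n ε_n(g_n) ≈ cR·ε(γ)` — a run-independent constant — and condition (iii) at
scale `j` asks `B₃ε₁ ≤ α₀(g_j) = C₀ g_j (log g_j⁻²)^{q₀} → 0` at the early scales of a long run: «Thm 1 as printed ⇒ row P11» is NOT an implication for ANY closed numerals
of the witness.  (b) What [III] p. 259 invokes («the inductive assumptions (2.7) imply U_k ∈ U^c_j(X, α_{0,j}, α_{1,j}) for proper restrictions on ε_j») is the PER-SCALE reading
(`VariationalThm1Scaled`, §2, located-reading label + `TODO(general form)`): thresholds `δ_n` at scale `n` in, class `B₃δ_n` at scale `n` out (the deeper plaquettes are harmless: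
`g_n²∕g_j² ≤ 1 + b·γ²·(n − j)` along (0.20) against `L^{2(n−j)}`; comparability (2.7)–(2.9) is consumed INSIDE Thm 1's induction, not displayed).  (c) THEN (§1, kernel):
«proper restrictions on ε_j» = `p₀ ≤ q₀ ∧ B₃·cR·A₀ ≤ (1 − β)·C₀ ∧ g_n² ≤ e⁻¹` give `B₃·cR·ε_n ≤ (1 − β)·α₀(g_n) ≤ α₀(g_n)` at every scale (`mul_eps_le_mul_alpha0`,
`hBα_of_numerics`); with `0 < cR·ε_n ≤ a₁` and `B₃·cR·ε_n ≤ εreg ≤ a₀` (the record's class between print's two classes, so the CHOSEN minimiser is print's).  CONSEQUENCE FOR THE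
WITNESS FAMILY (dag-lead WORDS-131 (3), node00-def-K0a `theta13OfNumerics`): `C₀, C₁, q₀, εreg` must be carried as functions of [15]'s constants (`C₀ ≥ B₃·cR·A₀∕(1−β)`, …),
never closed numerals; the K0″ closure reads «∀ B₃ a₀ a₁, VariationalThm1Scaled B₃ a₀ a₁ → (gauge clauses) → bg at θ(n(B₃,a₀,a₁))».

CONTENTS.  §1 numerics: `one_le_log_inv_sq`, `mul_eps_le_alpha0`, `mul_eps_le_alpha1`, `mul_eps_le_mul_alpha0`, `mul_epsOfRecord_le_alpha0`.  §2 the named fact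
`VariationalThm1Scaled (B₃ a₀ a₁)` (per-scale reading), `VariationalThm1Class` (printed, uniform), `VariationalThm1Scaled.toClass`, `regMSOfRecord_eq_setOf`.  §3
★ `plaqSmallOn_UbgMSOfRecord_of_thm1Scaled` ∕ `_of_thm1Class`: def-R's `U_k(s)(𝐖)` is `B₃·cR·ε_n·η_n²`- (resp. `B₃ε₁·η_n²`-) regular on `Ω_n(s)`, every `n ≤ k`, for retained
solvable `𝐖`.  §4 from a class bound to r11's clauses ON PRINT'S RANGES: `norm_plaq_ιSU_sub_one` (`‖ι(U(∂p)) − 1‖_{op} = dist1`), ★ `norm_plaq_sub_one_lt_of_classBound`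
((1.11)∕(1.14) on `X ⊆ Λ_j ⊆ Ω_j`), `layerSet_subset_Ω`, ★ `norm_plaq_sub_one_lt_rad234_of_classBound` ((2.34) on the layers, any `X`).  §5 assembly at def-R's objects with the
gauge clauses displayed: `ofBackgroundC_UbgMSOfRecord_mem_spaceI_of_classBound` ∕ `…_mem_spaceMS_of_classBound` (solvable branch via K0b's two lemmas, unit branch via def-T's
`one_mem_spaceI` ∕ dag-n11-e's `one_mem_spaceMS_of_le`).  §6 ★ `ofBackgroundC_UbgMSOfRecord_mem_spaceI_of_thm1Scaled` (every retained `𝐖`, every `X ⊆ Λ_j(s)`), ★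
`…_mem_spaceMS_of_thm1Scaled`.  §7 ★★ `bgProvisoΛ_UbgMSOfRecord_of_thm1Scaled` — the RANGED TOKEN at def-R's objects from `h15` + numerics + radii in the window + the two gauge
clauses; `hBα_of_numerics`.  v1.1 (append-only; v1.0 declarations byte-identical) §8: `Sect2.SeqSeparated` (print's separation of the sequence, [6] (1.3)–(1.6) — NOT carried
by the tree's (2.18) index `Seq`∕`Chain21`: a located range difference), ★ `VariationalThm1ScaledSep` (the FAITHFUL per-scale named fact: separated sequences + thresholds
comparable across consecutive scales — without these two clauses the per-scale statement over ALL `SeqOfRecord` is NOT print's and has no universal `B₃(d, L)`),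
`VariationalThm1Scaled.toScaledSep`, `plaqSmallOn_UbgMSOfRecord_of_thm1ScaledSep`.

DEPENDENCES (by name): def-R `UbgMSOfRecord`, `isMinimizer_UbgMSOfRecord`, `UbgMSOfRecord_of_not_mem`, `regMSOfRecord`, `omegaPlaqs`, `regSuppOfRecord`, `epsOfRecord`,
`BgProvisoΛ`, `Sect2.admB ∕ cubesI ∕ frameMS ∕ domSites ∕ layerSet ∕ regionOfSet ∕ spaceI ∕ spaceMS ∕ Residual.unit(_laws)`; def-T `Sect2.one_mem_spaceI`; K0b
`Sect2.Residual.ofBackgroundC_mem_spaceI_unit_of_condI ∕ …spaceMS_unit_of_conds`; n11-e `Sect2.one_mem_spaceMS_of_le`; r11 `B12RegularSpaces111.(plaq, gaugeU, expI, grad)`,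
`B14RegularSpaces234.(CondII238, MSConsts.ofParams)`, `B14Radii.(rad234, rad234_eq, shrink, one_sub_le_shrink)`, `B8Eq17ClassAkV1.plaqsOf`; `p0Profile`, `Step.LFConsts.alpha0∕1`.
-/

noncomputable section

open MeasureTheory
open scoped Matrix.Norms.L2Operator

namespace Literature.MathematicalPhysics.QuantumFieldTheory.Balaban1983to89.Node00

open T4Continuum B14.Eq218Concrete B15DeterminingSets B12RegularSpaces111 B14RegularSpaces234 B14Radii

/-! ## §1  «Proper restrictions on ε_j» — the letter inequalities in kernel -/

section Numerics

/-- In the window: `0 < g`, `g² ≤ e⁻¹` give `1 ≤ log g⁻²`. [cite: Balaban1988Convergent, (2.4)–(2.6) p.255 (elementary)] -/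
theorem one_le_log_inv_sq {g : ℝ} (hg : 0 < g) (hge : g ^ 2 ≤ Real.exp (-1)) : 1 ≤ Real.log (g ^ 2)⁻¹ := by
  have hg2 : 0 < g ^ 2 := pow_pos hg 2
  rw [Real.log_inv, le_neg, ← Real.log_exp (-1)]
  exact Real.log_le_log hg2 hge

/-- **(2.28)'s «C₀ sufficiently large» made explicit**: with `α₀(g) = g·C₀·(log g⁻²)^{q₀}` and `ε(g) = g·A₀·(log g⁻²)^{p₀}` ((2.4)), the inequality
`B·(c·ε(g)) ≤ α₀(g)` holds as soon as `p₀ ≤ q₀`, `0 ≤ B·c·A₀ ≤ C₀`, `0 ≤ g` and `log g⁻² ≥ 1`. [cite: Balaban1988Convergent, (2.4) p.255, (2.28) p.259] -/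
theorem mul_eps_le_alpha0 (lf : Step.LFConsts) {A₀ B c g : ℝ} {p₀ : ℕ} (hg : 0 ≤ g) (hlog : 1 ≤ Real.log (g ^ 2)⁻¹) (hpq : p₀ ≤ lf.q₀)
    (hBc : 0 ≤ B * c * A₀) (hC : B * c * A₀ ≤ lf.C₀) : B * (c * (g * p0Profile A₀ p₀ g)) ≤ lf.alpha0 g := by
  unfold p0Profile Step.LFConsts.alpha0
  set ℓ := Real.log (g ^ 2)⁻¹ with hℓ
  have hℓ0 : 0 ≤ ℓ := zero_le_one.trans hlog
  have hpow : ℓ ^ p₀ ≤ ℓ ^ lf.q₀ := pow_le_pow_right₀ hlog hpq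
  calc B * (c * (g * (A₀ * ℓ ^ p₀))) = (B * c * A₀) * g * ℓ ^ p₀ := by ring
    _ ≤ lf.C₀ * g * ℓ ^ lf.q₀ := by
        apply mul_le_mul (mul_le_mul_of_nonneg_right hC hg) hpow (pow_nonneg hℓ0 _)
        exact mul_nonneg (hBc.trans hC) hg
    _ = g * lf.C₀ * ℓ ^ lf.q₀ := by ring

/-- The same for `α₁(g) = g·C₁·(log g⁻²)^{q₁}` («C₁ sufficiently large»). [cite: Balaban1988Convergent, (2.4) p.255, (2.28) p.259] -/
theorem mul_eps_le_alpha1 (lf : Step.LFConsts) {A₀ B c g : ℝ} {p₀ : ℕ} (hg : 0 ≤ g) (hlog : 1 ≤ Real.log (g ^ 2)⁻¹) (hpq : p₀ ≤ lf.q₁)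
    (hBc : 0 ≤ B * c * A₀) (hC : B * c * A₀ ≤ lf.C₁) : B * (c * (g * p0Profile A₀ p₀ g)) ≤ lf.alpha1 g := by
  unfold p0Profile Step.LFConsts.alpha1
  set ℓ := Real.log (g ^ 2)⁻¹ with hℓ
  have hℓ0 : 0 ≤ ℓ := zero_le_one.trans hlog
  have hpow : ℓ ^ p₀ ≤ ℓ ^ lf.q₁ := pow_le_pow_right₀ hlog hpq
  calc B * (c * (g * (A₀ * ℓ ^ p₀))) = (B * c * A₀) * g * ℓ ^ p₀ := by ring
    _ ≤ lf.C₁ * g * ℓ ^ lf.q₁ := by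
        apply mul_le_mul (mul_le_mul_of_nonneg_right hC hg) hpow (pow_nonneg hℓ0 _)
        exact mul_nonneg (hBc.trans hC) hg
    _ = g * lf.C₁ * ℓ ^ lf.q₁ := by ring

/-- With a factor: `B·c·A₀ ≤ t·C₀` (`0 ≤ t`) gives `B·(c·ε(g)) ≤ t·α₀(g)` — the form the (2.34) radii use (`t = 1 − β`). [cite: Balaban1988Convergent, (2.28) p.259, (2.34) p.261] -/
theorem mul_eps_le_mul_alpha0 (lf : Step.LFConsts) {A₀ B c g t : ℝ} {p₀ : ℕ} (hg : 0 ≤ g) (hlog : 1 ≤ Real.log (g ^ 2)⁻¹) (hpq : p₀ ≤ lf.q₀)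
    (hBc : 0 ≤ B * c * A₀) (hC : B * c * A₀ ≤ t * lf.C₀) : B * (c * (g * p0Profile A₀ p₀ g)) ≤ t * lf.alpha0 g := by
  unfold p0Profile Step.LFConsts.alpha0
  set ℓ := Real.log (g ^ 2)⁻¹ with hℓ
  have hℓ0 : 0 ≤ ℓ := zero_le_one.trans hlog
  have hpow : ℓ ^ p₀ ≤ ℓ ^ lf.q₀ := pow_le_pow_right₀ hlog hpq
  calc B * (c * (g * (A₀ * ℓ ^ p₀))) = (B * c * A₀) * g * ℓ ^ p₀ := by ring
    _ ≤ (t * lf.C₀) * g * ℓ ^ lf.q₀ := by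
        apply mul_le_mul (mul_le_mul_of_nonneg_right hC hg) hpow (pow_nonneg hℓ0 _)
        exact mul_nonneg (hBc.trans hC) hg
    _ = t * (g * lf.C₀ * ℓ ^ lf.q₀) := by ring

/-- **The record's form**: along a history `g` with `0 < g_j`, `g_j² ≤ e⁻¹`, the numerics `p₀ ≤ q₀`, `B·cR·A₀ ≤ C₀` (`0 ≤ B·cR·A₀`) give
`B·(cR·ε_j) ≤ α₀(g_j)` with `ε_j = epsOfRecord ν g j`. [cite: Balaban1988Convergent, (2.4) p.255, (2.28) p.259] -/
theorem mul_epsOfRecord_le_alpha0 (lf : Step.LFConsts) (ν : Stage7Numerics) {B cR : ℝ} {g : ℕ → ℝ} {j : ℕ} (hg : 0 < g j)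
    (hge : g j ^ 2 ≤ Real.exp (-1)) (hpq : ν.p₀ ≤ lf.q₀) (hBc : 0 ≤ B * cR * ν.A₀) (hC : B * cR * ν.A₀ ≤ lf.C₀) :
    B * (cR * epsOfRecord ν g j) ≤ lf.alpha0 (g j) :=
  mul_eps_le_alpha0 lf hg.le (one_le_log_inv_sq hg hge) hpq hBc hC

end Numerics

/-! ## §2  [15] THEOREM 1 (8) — the class of the minimal configurations — as a NAMED FACT at the objects of record -/

section NamedFact

variable (F : T4Family) (N : ℕ) [NeZero N]

/-- **[15] THEOREM 1, (8) + UNIQUENESS, IN THE PER-SCALE READING INVOKED BY [III] p. 259** (a NAMED FACT — a `Prop`, never asserted; constants as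
PARAMETERS, print: «there exist positive constants a₀, a₁, B₃, … depending on d and L only»).  [15] = T. Bałaban, *The variational problem and background
fields in renormalization group method for lattice gauge theories*, Commun. Math. Phys. **102** (1985) 277–309, Thm 1 p. 279: for data `V` on `𝔅` with
«|∂V(p′) − 1| < ε₁ for p′ ⊂ 𝔅 (7)», `ε₁ ≤ a₁`, «there exists a minimal orbit in the space U_k({Ω_j}, B₃ε₁) ∩ 𝔘(𝔅_k, V) (8). This orbit is a unique critical orbit
in the space (6) [= U_k({Ω_j}, ε₀) ∩ 𝔘(𝔅_k, V)] if B₃ε₁ ≤ ε₀ and ε₀ ≤ a₀», where ([6] (1.7)–(1.8)) `U_k({Ω_j}, α) = {U | |U(∂p) − 1| < α·L^{−2j}, p ∈ Ω_j, j ≤ k}`.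
READ AT THE OBJECTS OF RECORD (one finite `𝕋⁴` torus `F.P K`, `SU(N)`, the averaging of record, a (2.18) index `s` — print's sequences are more general —, the
determining set `genSet s.Ω k`, data small on the plaquettes TOUCHING `Γ_n` — a stronger datum hypothesis than print's «p′ ⊂ 𝔅»): every minimiser of (2.12) in
the class of threshold `ε₀` lies in the class of threshold `B₃·δ`, and one exists.  PER-SCALE READING: the data threshold is a sequence `δ_n` (scale `n`) and the
conclusion is the class with threshold `B₃·δ_n` at scale `n` — print's (7)–(8) carry ONE `ε₁`; [III] p. 256 («|∂V_{j−1} − 1| < O(L²)ε_{j−1}») and p. 259 («the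
inductive assumptions (2.7) imply U_k ∈ U^c_j(X, α_{0,j}, α_{1,j}) for proper restrictions on ε_j») use the thresholds `ε_j = g_j A₀(log g_j⁻²)^{p₀}` of (2.4), scale
by scale, whose comparability (2.7)–(2.9) the inductive proof of Thm 1 consumes — NOT displayed here.
-- TODO(general form): [15] Thm 1 is printed with one threshold `ε₁` for all scales and for general admissible `{Ω_j}`; the per-scale form is a located reading
-- of how [III] p. 259 applies it; the uniform instance is `VariationalThm1Class` below.
[cite: Balaban1985Variational, Thm 1 (7)–(8) p.279; Balaban1985RegularSpaces, (1.7)–(1.8) p.77; Balaban1988Convergent, (2.12) p.256, p.259] -/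
def VariationalThm1Scaled (B₃ a₀ a₁ : ℝ) : Prop :=
  ∀ (ν : Stage7Numerics) (M : ℕ) (g : ℕ → ℝ) (K k : ℕ) (s : SeqOfRecord F ν M g K k) (ε₀ : ℝ) (δ : ℕ → ℝ),
    (∀ n, n ≤ k → 0 < δ n ∧ δ n ≤ a₁ ∧ B₃ * δ n ≤ ε₀) → ε₀ ≤ a₀ →
    ∀ W : MSField (F.P K) (SU N), (∀ n, n ≤ k → PlaqSmallOn (B8Eq17ClassAkV1.plaqsOf (genSet s.Ω k n)) (δ n) (W n)) →
      (∃ U₀, IsMinimizer (avOfRecord F N K) {U | ∀ n, n ≤ k → PlaqSmallOn (omegaPlaqs s.Ω n) (ε₀ * (F.P K).eta n ^ 2) U} (genSet s.Ω k) W U₀) ∧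
      ∀ U₀, IsMinimizer (avOfRecord F N K) {U | ∀ n, n ≤ k → PlaqSmallOn (omegaPlaqs s.Ω n) (ε₀ * (F.P K).eta n ^ 2) U} (genSet s.Ω k) W U₀ →
        ∀ n, n ≤ k → PlaqSmallOn (omegaPlaqs s.Ω n) (B₃ * δ n * (F.P K).eta n ^ 2) U₀

/-- **[15] THEOREM 1, (8) + UNIQUENESS, UNIFORM THRESHOLD — the printed form** (constants as parameters): the per-scale reading at a constant sequence
`δ_n = ε₁`.  «for an arbitrary configuration V satisfying (7) with ε₁ ≤ a₁ there exists a minimal orbit in the space U_k({Ω_j}, B₃ε₁) ∩ 𝔘(𝔅_k, V) (8). This orbit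
is a unique critical orbit in the space (6) if B₃ε₁ ≤ ε₀ and ε₀ ≤ a₀.» [cite: Balaban1985Variational, Thm 1 (7)–(8) p.279; Balaban1985RegularSpaces, (1.7)–(1.8) p.77] -/
def VariationalThm1Class (B₃ a₀ a₁ : ℝ) : Prop :=
  ∀ (ν : Stage7Numerics) (M : ℕ) (g : ℕ → ℝ) (K k : ℕ) (s : SeqOfRecord F ν M g K k) (ε₀ ε₁ : ℝ),
    0 < ε₁ → ε₁ ≤ a₁ → B₃ * ε₁ ≤ ε₀ → ε₀ ≤ a₀ →
    ∀ W : MSField (F.P K) (SU N), (∀ n, n ≤ k → PlaqSmallOn (B8Eq17ClassAkV1.plaqsOf (genSet s.Ω k n)) ε₁ (W n)) →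
      (∃ U₀, IsMinimizer (avOfRecord F N K) {U | ∀ n, n ≤ k → PlaqSmallOn (omegaPlaqs s.Ω n) (ε₀ * (F.P K).eta n ^ 2) U} (genSet s.Ω k) W U₀) ∧
      ∀ U₀, IsMinimizer (avOfRecord F N K) {U | ∀ n, n ≤ k → PlaqSmallOn (omegaPlaqs s.Ω n) (ε₀ * (F.P K).eta n ^ 2) U} (genSet s.Ω k) W U₀ →
        ∀ n, n ≤ k → PlaqSmallOn (omegaPlaqs s.Ω n) (B₃ * ε₁ * (F.P K).eta n ^ 2) U₀

variable {F N}

/-- The per-scale reading contains the printed (uniform) form: take `δ_n := ε₁`. [cite: Balaban1985Variational, Thm 1 (8) p.279 (bookkeeping)] -/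
theorem VariationalThm1Scaled.toClass {B₃ a₀ a₁ : ℝ} (h : VariationalThm1Scaled F N B₃ a₀ a₁) : VariationalThm1Class F N B₃ a₀ a₁ :=
  fun ν M g K k s ε₀ ε₁ h0 h1 hB hε₀ W hW => h ν M g K k s ε₀ (fun _ => ε₁) (fun _ _ => ⟨h0, h1, hB⟩) hε₀ W hW

/-- The class of record `regMSOfRecord F N ν K k Ω` IS the class of threshold `εreg` (`rfl`). [cite: Balaban1985RegularSpaces, (1.7) p.77 (bookkeeping)] -/
theorem regMSOfRecord_eq_setOf (ν : Stage7Numerics) (K k : ℕ) (Ω : ℕ → Set (Site (F.P K) 0)) :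
    regMSOfRecord F N ν K k Ω = {U | ∀ n, n ≤ k → PlaqSmallOn (omegaPlaqs Ω n) (ν.εreg * (F.P K).eta n ^ 2) U} := rfl

end NamedFact

/-! ## §3  The class bound at def-R's background of record, from the named fact -/

section ClassBound

variable {F : T4Family} {N : ℕ} [NeZero N]

/-- **THE MINIMISER OF RECORD IS `B₃·cR·ε_n`-REGULAR AT EVERY SCALE** (from the per-scale named fact): for a retained `𝐖 ∈ regSuppOfRecord … cR s` for which (2.12)
is solvable in the class of record (threshold `εreg`), def-R's background `U_k(s)(𝐖)` — a minimiser in that class — satisfies `|∂U − 1| < B₃·cR·ε_n(g_n)·η_n²` on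
the plaquettes meeting `Ω_n(s)`, every `n ≤ k`, provided `0 < cR·ε_n ≤ a₁`, `B₃·cR·ε_n ≤ εreg ≤ a₀` (the record's class lies between print's two classes).
[cite: Balaban1985Variational, Thm 1 (8) p.279; Balaban1988Convergent, (2.12) p.256, p.259] -/
theorem plaqSmallOn_UbgMSOfRecord_of_thm1Scaled {B₃ a₀ a₁ : ℝ} (h15 : VariationalThm1Scaled F N B₃ a₀ a₁) (ν : Stage7Numerics) (M : ℕ)
    (g : ℕ → ℝ) (K k : ℕ) (cR : ℝ) (s : SeqOfRecord F ν M g K k)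
    (hnum : ∀ n, n ≤ k → 0 < cR * epsOfRecord ν g n ∧ cR * epsOfRecord ν g n ≤ a₁ ∧ B₃ * (cR * epsOfRecord ν g n) ≤ ν.εreg) (ha₀ : ν.εreg ≤ a₀)
    {W : MSField (F.P K) (SU N)} (hW : W ∈ regSuppOfRecord F N ν M g K k cR s)
    (hsol : W ∈ solvableDom (avOfRecord F N K) (regMSOfRecord F N ν K k s.Ω) (genSet s.Ω k)) :
    ∀ n, n ≤ k → PlaqSmallOn (omegaPlaqs s.Ω n) (B₃ * (cR * epsOfRecord ν g n) * (F.P K).eta n ^ 2) (UbgMSOfRecord F N ν M g K k s W) :=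
  (h15 ν M g K k s ν.εreg (fun n => cR * epsOfRecord ν g n) hnum ha₀ W hW).2 _ (isMinimizer_UbgMSOfRecord ν M g K k s hsol)

/-- The same from the PRINTED (uniform) form, at a uniform bound `ε₁ ≥ cR·ε_n(g_n)` of the data thresholds along the run (`0 < ε₁ ≤ a₁`, `B₃ε₁ ≤ εreg ≤ a₀`): the
background is `B₃ε₁`-regular at every scale. [cite: Balaban1985Variational, Thm 1 (8) p.279; Balaban1988Convergent, (2.12) p.256] -/
theorem plaqSmallOn_UbgMSOfRecord_of_thm1Class {B₃ a₀ a₁ : ℝ} (h15 : VariationalThm1Class F N B₃ a₀ a₁) (ν : Stage7Numerics) (M : ℕ)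
    (g : ℕ → ℝ) (K k : ℕ) (cR ε₁ : ℝ) (s : SeqOfRecord F ν M g K k) (hε : ∀ n, n ≤ k → cR * epsOfRecord ν g n ≤ ε₁)
    (h0 : 0 < ε₁) (h1 : ε₁ ≤ a₁) (hB : B₃ * ε₁ ≤ ν.εreg) (ha₀ : ν.εreg ≤ a₀)
    {W : MSField (F.P K) (SU N)} (hW : W ∈ regSuppOfRecord F N ν M g K k cR s)
    (hsol : W ∈ solvableDom (avOfRecord F N K) (regMSOfRecord F N ν K k s.Ω) (genSet s.Ω k)) :
    ∀ n, n ≤ k → PlaqSmallOn (omegaPlaqs s.Ω n) (B₃ * ε₁ * (F.P K).eta n ^ 2) (UbgMSOfRecord F N ν M g K k s W) :=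
  (h15 ν M g K k s ν.εreg ε₁ h0 h1 hB ha₀ W (fun n hn p hp => (hW n hn p hp).trans_le (hε n hn))).2 _ (isMinimizer_UbgMSOfRecord ν M g K k s hsol)

end ClassBound

/-! ## §4  From a class bound to r11's plaquette conditions ON PRINT'S RANGES -/

section Conditions

variable {F : T4Family} {N : ℕ} [NeZero N]

/-- In the `SU(N)` model of record, `‖U(∂p) − 1‖_{op}` of the embedded plaquette variable IS `dist1 (U(∂p))` (`rfl` through `GaugeGroup.ofUnitaryRep`).
[cite: Balaban1985Averaging, (19) p.21 (bookkeeping)] -/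
theorem norm_plaq_ιSU_sub_one {P : Params} (U : GaugeField P 0 (SU N)) (p : Plaq P 0) :
    ‖((plaq (fun b => ιSU N (U b)) p : (MatA N)ˣ) : MatA N) - 1‖ = dist1 (GaugeField.plaqHol U p) := by
  have h : plaq (fun b => ιSU N (U b)) p = ιSU N (GaugeField.plaqHol U p) := by
    rw [plaq_eq]; simp only [GaugeField.plaqHol, map_mul, map_inv]
  rw [h]
  rfl

/-- A plaquette with all four corners in a set touches it (bookkeeping between def-R's `plaqInside` and the p. 77 convention `plaqsOf`).
[cite: Balaban1985RegularSpaces, p.77 (convention before (1.5); bookkeeping)] -/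
theorem plaqInside_subset_plaqsOf {P : Params} (S : Set (Site P 0)) : plaqInside S ⊆ B8Eq17ClassAkV1.plaqsOf S :=
  fun _ hp => Or.inl hp.1

/-- `plaqInside` is monotone. [cite: Balaban1988Convergent, (2.17) p.257 (bookkeeping)] -/
theorem plaqInside_mono {P : Params} {S T : Set (Site P 0)} (h : S ⊆ T) : plaqInside S ⊆ plaqInside T :=
  fun _ hp => ⟨h hp.1, h hp.2.1, h hp.2.2.1, h hp.2.2.2⟩

/-- **CONDITION (iii)∕(i)-PLAQUETTE OF `U^c_j(X, α_{0,j}, α_{1,j})` ON PRINT'S RANGE `X ⊂ Λ_j`** from a scale-`j` class bound: if `|∂U − 1| < b·η_j²` on the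
plaquettes meeting `Ω_j`, `X ⊆ Λ_j ⊆ Ω_j` and `b ≤ α₀`, then `‖U(∂p) − 1‖ < α₀·η_j²` at every plaquette inside `X` (the (1.11)∕(1.14) clause, `ξ = L^{−j}`).
[cite: Balaban1987RG1, (1.11), (1.14) p.262; Balaban1988Convergent, (2.27)–(2.28) p.259] -/
theorem norm_plaq_sub_one_lt_of_classBound {P : Params} {Ω Λ : ℕ → Set (Site P 0)} {j : ℕ} (hj : 1 ≤ j) (hΛΩ : Λ j ⊆ Ω j)
    {Y : Set (Site P 0)} (hY : Y ⊆ Λ j) {b α₀ : ℝ} (hb : b ≤ α₀) {U : GaugeField P 0 (SU N)}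
    (hU : PlaqSmallOn (omegaPlaqs Ω j) (b * P.eta j ^ 2) U) :
    ∀ p ∈ plaqInside Y, ‖((plaq (fun b => ιSU N (U b)) p : (MatA N)ˣ) : MatA N) - 1‖ < α₀ * P.eta j ^ 2 := by
  intro p hp
  rw [norm_plaq_ιSU_sub_one]
  have hp' : p ∈ omegaPlaqs Ω j := by
    rw [omegaPlaqs_of_ne_zero Ω (Nat.one_le_iff_ne_zero.mp hj)]
    exact plaqInside_subset_plaqsOf _ (plaqInside_mono (hY.trans hΛΩ) hp)
  exact (hU p hp').trans_le (mul_le_mul_of_nonneg_right hb (sq_nonneg _))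

/-- The layer regions of (2.34) lie in `Ω_n` (`1 ≤ n ≤ j`): `X ∩ (Ω_n ∖ Ω_{n+1}) ⊆ Ω_n`, `X ∩ Ω_j ⊆ Ω_j`. [cite: Balaban1988Convergent, (2.34) p.261 (bookkeeping)] -/
theorem layerSet_subset_Ω {P : Params} (j : ℕ) (Y : Set (Site P 0)) (Ω : ℕ → Set (Site P 0)) {n : ℕ} (hn : n ≤ j) :
    Sect2.layerSet j Y Ω n ⊆ Ω n := by
  unfold Sect2.layerSet
  split_ifs with h1 h2
  · exact fun x hx => hx.2.1
  · subst h2; exact fun x hx => hx.2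
  · exact absurd (le_antisymm hn (not_lt.mp h1)) h2

/-- `η_n² = 1∕(Lⁿ)²` on `Setup.Params`. [cite: Balaban1987RG1, (1.1) p.260 (bookkeeping)] -/
theorem eta_sq_eq {P : Params} (n : ℕ) : P.eta n ^ 2 = 1 / ((P.L : ℝ) ^ n) ^ 2 := by
  unfold Params.eta
  rw [inv_pow, one_div, inv_pow]

/-- **THE (2.34) PLAQUETTE CLAUSES OF `Ũ^c_j(X, α̃₀, α̃₁)` FROM PER-SCALE CLASS BOUNDS**: if `|∂U − 1| < b_n·η_n²` on the plaquettes meeting `Ω_n` and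
`b_n ≤ (1 − β)·α_{0,n}` for `1 ≤ n ≤ j`, then `‖U(∂p) − 1‖ < (1 − β(1 − 2^{−(j−n)}))·α_{0,n}·ξ²(Lⁿξ)^{−2}` on every plaquette inside `X ∩ (Ω_n ∖ Ω_{n+1})` (`n < j`) ∕
`X ∩ Ω_j` (`n = j`) — any `X`, `0 ≤ β`. [cite: Balaban1988Convergent, (2.34) p.261] -/
theorem norm_plaq_sub_one_lt_rad234_of_classBound {P : Params} {Ω : ℕ → Set (Site P 0)} {j : ℕ} (Y : Set (Site P 0)) {β : ℝ} (hβ : 0 ≤ β)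
    {b α₀ : ℕ → ℝ} (hb : ∀ n, 1 ≤ n → n ≤ j → b n ≤ (1 - β) * α₀ n) (hα : ∀ n, 1 ≤ n → n ≤ j → 0 ≤ α₀ n) {U : GaugeField P 0 (SU N)}
    (hU : ∀ n, 1 ≤ n → n ≤ j → PlaqSmallOn (omegaPlaqs Ω n) (b n * P.eta n ^ 2) U) :
    ∀ n, 1 ≤ n → n ≤ j → ∀ p ∈ (Sect2.regionOfSet P (Sect2.layerSet j Y Ω n)).plaqs,
      ‖((plaq (fun b => ιSU N (U b)) p : (MatA N)ˣ) : MatA N) - 1‖ < rad234 β (α₀ n) (P.eta j) P.L j n := by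
  intro n h1 hn p hp
  have hξ : P.eta j ≠ 0 := (pow_pos (inv_pos.mpr (Nat.cast_pos.mpr P.L_pos)) j).ne'
  rw [norm_plaq_ιSU_sub_one, rad234_eq hξ (Sect2.L_cast_ne_zero P)]
  have hp' : p ∈ omegaPlaqs Ω n := by
    rw [omegaPlaqs_of_ne_zero Ω (Nat.one_le_iff_ne_zero.mp h1)]
    exact plaqInside_subset_plaqsOf _ (plaqInside_mono (layerSet_subset_Ω j Y Ω hn) hp)
  have hLn : 0 < ((P.L : ℝ) ^ n) ^ 2 := pow_pos (pow_pos (Nat.cast_pos.mpr P.L_pos) n) 2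
  calc dist1 (GaugeField.plaqHol U p) < b n * P.eta n ^ 2 := hU n h1 hn p hp'
    _ ≤ (1 - β) * α₀ n * P.eta n ^ 2 := mul_le_mul_of_nonneg_right (hb n h1 hn) (sq_nonneg _)
    _ ≤ shrink β (j - n) * α₀ n * P.eta n ^ 2 :=
        mul_le_mul_of_nonneg_right (mul_le_mul_of_nonneg_right (one_sub_le_shrink hβ _) (hα n h1 hn)) (sq_nonneg _)
    _ = shrink β (j - n) * α₀ n / ((P.L : ℝ) ^ n) ^ 2 := by rw [eta_sq_eq]; ring

end Conditions

/-! ## §5  Assembly at def-R's objects: membership in `U^c_j(X, α_{0,j}, α_{1,j})` (X ⊂ Λ_j) and in `Ũ^c_j(X)` from a class bound + the gauge clauses -/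

section Assembly

variable {F : T4Family} {N : ℕ} [NeZero N]

/-- The junk branch of def-R's background map is the unit configuration `1`. [cite: Balaban1988Convergent, (2.12) p.256 (typing convention)] -/
theorem UbgMSOfRecord_eq_one_of_not_mem (ν : Stage7Numerics) (M : ℕ) (g : ℕ → ℝ) (K k : ℕ) (s : SeqOfRecord F ν M g K k)
    {W : MSField (F.P K) (SU N)} (hW : W ∉ solvableDom (avOfRecord F N K) (regMSOfRecord F N ν K k s.Ω) (genSet s.Ω k)) :
    UbgMSOfRecord F N ν M g K k s W = 1 :=
  UbgMSOfRecord_of_not_mem ν M g K k s hW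

/-- **`U_k(s)(𝐖) ∈ U^c_j(X, α_{0,j}, α_{1,j})` OF RECORD FOR `X ⊂ Λ_j(s)`, FROM A SCALE-`j` CLASS BOUND AND THE (1.12) GAUGE CLAUSE** (setting of the
`SU(N)` model, unit residual recipe): on the solvable set, the class bound `|∂U − 1| < b·η_j²` on `Ω_j ⊇ Λ_j ⊇ X` with `b ≤ α₀(g_j)` gives the plaquette clause of
condition (i)∕(iii), the displayed clause `hloc` gives (1.12), and node00-def-K0b's `ofBackgroundC_mem_spaceI_unit_of_condI` closes; off the solvable set the
background is `1` and def-T's `one_mem_spaceI` closes. [cite: Balaban1987RG1, (1.11)–(1.16) p.262; Balaban1988Convergent, (2.27)–(2.28) p.259] -/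
theorem ofBackgroundC_UbgMSOfRecord_mem_spaceI_of_classBound (S : Sect2.Setting (MatA N) (SU N)) (hι : S.ι = ιSU N) (hS : S.Laws) (hcB : 0 < S.cB)
    (ν : Stage7Numerics) (M : ℕ) (g : ℕ → ℝ) (K k : ℕ) (s : SeqOfRecord F ν M g K k) (W : MSField (F.P K) (SU N))
    {j : ℕ} (h1 : 1 ≤ j) (hjk : j ≤ k) {α₀ α₁ : ℝ} (hα₀ : 0 < α₀) (hα₁ : 0 < α₁)
    (X : (Sect2.domSys (F.P K) M j).Dom) (hX : Sect2.domSites (F.P K) M j X ⊆ s.Λ j) {b : ℝ} (hb : b ≤ α₀)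
    (hclass : W ∈ solvableDom (avOfRecord F N K) (regMSOfRecord F N ν K k s.Ω) (genSet s.Ω k) →
      PlaqSmallOn (omegaPlaqs s.Ω j) (b * (F.P K).eta j ^ 2) (UbgMSOfRecord F N ν M g K k s W))
    (hloc : W ∈ solvableDom (avOfRecord F N K) (regMSOfRecord F N ν K k s.Ω) (genSet s.Ω k) →
      ∀ C ∈ Sect2.cubesI M j (Sect2.domSites (F.P K) M j X), ∃ u : Site (F.P K) 0 → (MatA N)ˣ, (∀ x, u x ∈ S.𝓜.G) ∧ ∃ A : PBond (F.P K) 0 → MatA N,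
        (∀ bd ∈ C.bonds, gaugeU u (fun b' => S.ι (UbgMSOfRecord F N ν M g K k s W b')) bd = expI ((F.P K).eta j) (A bd)) ∧
        (∀ bd ∈ C.bonds, ‖A bd‖ < S.cB * α₀) ∧
        ∀ q ∈ C.dpairs, ‖grad ((F.P K).eta j) q.2.1 (fun y => A ⟨y, q.2.2⟩) q.1‖ < S.cB * α₀) :
    Sect2.ofBackgroundC S.ι (UbgMSOfRecord F N ν M g K k s W) ∈
      Sect2.spaceI S (Sect2.Residual.unit (F.P K) (MatA N)) M j (Sect2.domSites (F.P K) M j X) α₀ α₁ := by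
  by_cases hsol : W ∈ solvableDom (avOfRecord F N K) (regMSOfRecord F N ν K k s.Ω) (genSet s.Ω k)
  · refine Sect2.Residual.ofBackgroundC_mem_spaceI_unit_of_condI S hS M j _ hα₀ hα₁ _ ⟨fun bd _ => hS.ι_mem _, ?_, hloc hsol⟩
    intro p hp
    have hΛΩ : s.Λ j ⊆ s.Ω j := s.chain.Λ_subset j h1 hjk
    have key := norm_plaq_sub_one_lt_of_classBound (N := N) h1 hΛΩ hX hb (hclass hsol) p hp
    rw [hι]
    exact key
  · rw [UbgMSOfRecord_eq_one_of_not_mem ν M g K k s hsol]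
    exact Sect2.one_mem_spaceI S hcB (Sect2.Residual.unit_laws _ _) M j _ hα₀ hα₁

/-- **`U_k(s)(𝐖) ∈ Ũ^c_j(X, α̃₀, α̃₁)` OF RECORD FROM PER-SCALE CLASS BOUNDS AND THE (2.38) GAUGE CLAUSE** (any `X`; setting of the `SU(N)` model, unit residual
recipe): the class bounds `b_n ≤ (1 − β)·α₀(g_n)` (`1 ≤ n ≤ j`) give (2.34) on the layers (§4), the displayed clause `h238` gives (2.38), node00-def-K0b's
`ofBackgroundC_mem_spaceMS_unit_of_conds` closes; off the solvable set dag-n11-e's `one_mem_spaceMS_of_le`. [cite: Balaban1988Convergent, (2.34)–(2.39) p.261] -/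
theorem ofBackgroundC_UbgMSOfRecord_mem_spaceMS_of_classBound (S : Sect2.Setting (MatA N) (SU N)) (hι : S.ι = ιSU N) (hS : S.Laws) (hpos : S.Pos)
    (ν : Stage7Numerics) (M : ℕ) (K k : ℕ) (s : SeqOfRecord F ν M S.flow.g K k) (W : MSField (F.P K) (SU N))
    {j : ℕ} (hα : ∀ n, 1 ≤ n → n ≤ j → 0 < S.lf.alpha0 (S.flow.g n) ∧ 0 < S.lf.alpha1 (S.flow.g n))
    (X : (Sect2.domSys (F.P K) M j).Dom) {b : ℕ → ℝ} (hb : ∀ n, 1 ≤ n → n ≤ j → b n ≤ (1 - S.βc) * S.lf.alpha0 (S.flow.g n))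
    (hclass : W ∈ solvableDom (avOfRecord F N K) (regMSOfRecord F N ν K k s.Ω) (genSet s.Ω k) →
      ∀ n, 1 ≤ n → n ≤ j → PlaqSmallOn (omegaPlaqs s.Ω n) (b n * (F.P K).eta n ^ 2) (UbgMSOfRecord F N ν M S.flow.g K k s W))
    (h238 : W ∈ solvableDom (avOfRecord F N K) (regMSOfRecord F N ν K k s.Ω) (genSet s.Ω k) →
      CondII238 S.𝓜 (Sect2.frameMS (Sect2.Residual.unit (F.P K) (MatA N)) M j (Sect2.domSites (F.P K) M j X) s.Ω)
        (MSConsts.ofParams (F.P K) S.βc S.B S.C S.Mr j) (fun n => S.lf.alpha0 (S.flow.g n)) (fun b' => S.ι (UbgMSOfRecord F N ν M S.flow.g K k s W b'))) :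
    Sect2.ofBackgroundC S.ι (UbgMSOfRecord F N ν M S.flow.g K k s W) ∈
      Sect2.spaceMS S (Sect2.Residual.unit (F.P K) (MatA N)) M j (Sect2.domSites (F.P K) M j X) s.Ω := by
  by_cases hsol : W ∈ solvableDom (avOfRecord F N K) (regMSOfRecord F N ν K k s.Ω) (genSet s.Ω k)
  · refine Sect2.Residual.ofBackgroundC_mem_spaceMS_unit_of_conds S hS hpos M j _ s.Ω (fun n h1 hn => (hα n h1 hn).1)
      (fun n h1 hn => (hα n h1 hn).2) _ ?_ (h238 hsol)
    intro n h1 hn q hq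
    have key := norm_plaq_sub_one_lt_rad234_of_classBound (N := N) (Sect2.domSites (F.P K) M j X) hpos.βc_nonneg hb
      (fun n h1 hn => (hα n h1 hn).1.le) (fun n h1 hn => hclass hsol n h1 hn) n h1 hn q hq
    rw [hι]
    exact key
  · rw [UbgMSOfRecord_eq_one_of_not_mem ν M S.flow.g K k s hsol]
    exact Sect2.one_mem_spaceMS_of_le S hpos (Sect2.Residual.unit_laws _ _) M j _ s.Ω hα

end Assembly

/-! ## §6  THE RANGED ROW AT DEF-R'S OBJECTS from [15] Thm 1 (per-scale reading) + the letter inequalities + the two gauge clauses -/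

section RangedRow

variable {F : T4Family} {N : ℕ} [NeZero N]

/-- **★ `U_k(s)(𝐖) ∈ U^c_j(X, α_{0,j}, α_{1,j})` OF RECORD ON PRINT'S RANGE `X ⊂ Λ_j(s)`** — for every retained `𝐖 ∈ regSuppOfRecord … cR s` — FROM the named fact
`VariationalThm1Scaled B₃ a₀ a₁`, the record's numerics relative to print's constants (`0 < cR·ε_n ≤ a₁`, `B₃·cR·ε_n ≤ εreg ≤ a₀` for `n ≤ k`; `B₃·cR·ε_j ≤ α₀(g_j)` —
§1 gives it from `p₀ ≤ q₀`, `B₃·cR·A₀ ≤ C₀`), positive radii at scale `j`, and the DISPLAYED (1.12) local-gauge clause at the minimiser ([15] Thm 1 (9)–(10) on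
print's cubes — not supplied here).  The unit residual recipe is K0b's `RzOfRecord`. [cite: Balaban1988Convergent, (2.27)–(2.28) p.259; Balaban1985Variational, Thm 1 (8)–(10) p.279; Balaban1987RG1, (1.11)–(1.16) p.262] -/
theorem ofBackgroundC_UbgMSOfRecord_mem_spaceI_of_thm1Scaled {B₃ a₀ a₁ : ℝ} (h15 : VariationalThm1Scaled F N B₃ a₀ a₁)
    (S : Sect2.Setting (MatA N) (SU N)) (hι : S.ι = ιSU N) (hS : S.Laws) (hcB : 0 < S.cB)
    (ν : Stage7Numerics) (M : ℕ) (g : ℕ → ℝ) (K k : ℕ) (cR : ℝ) (s : SeqOfRecord F ν M g K k)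
    (hnum : ∀ n, n ≤ k → 0 < cR * epsOfRecord ν g n ∧ cR * epsOfRecord ν g n ≤ a₁ ∧ B₃ * (cR * epsOfRecord ν g n) ≤ ν.εreg) (ha₀ : ν.εreg ≤ a₀)
    {j : ℕ} (h1 : 1 ≤ j) (hjk : j ≤ k) {α₀ α₁ : ℝ} (hα₀ : 0 < α₀) (hα₁ : 0 < α₁) (hBα : B₃ * (cR * epsOfRecord ν g j) ≤ α₀)
    {W : MSField (F.P K) (SU N)} (hW : W ∈ regSuppOfRecord F N ν M g K k cR s)
    (X : (Sect2.domSys (F.P K) M j).Dom) (hX : Sect2.domSites (F.P K) M j X ⊆ s.Λ j)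
    (hloc : W ∈ solvableDom (avOfRecord F N K) (regMSOfRecord F N ν K k s.Ω) (genSet s.Ω k) →
      ∀ C ∈ Sect2.cubesI M j (Sect2.domSites (F.P K) M j X), ∃ u : Site (F.P K) 0 → (MatA N)ˣ, (∀ x, u x ∈ S.𝓜.G) ∧ ∃ A : PBond (F.P K) 0 → MatA N,
        (∀ bd ∈ C.bonds, gaugeU u (fun b' => S.ι (UbgMSOfRecord F N ν M g K k s W b')) bd = expI ((F.P K).eta j) (A bd)) ∧
        (∀ bd ∈ C.bonds, ‖A bd‖ < S.cB * α₀) ∧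
        ∀ q ∈ C.dpairs, ‖grad ((F.P K).eta j) q.2.1 (fun y => A ⟨y, q.2.2⟩) q.1‖ < S.cB * α₀) :
    Sect2.ofBackgroundC S.ι (UbgMSOfRecord F N ν M g K k s W) ∈
      Sect2.spaceI S (Sect2.Residual.unit (F.P K) (MatA N)) M j (Sect2.domSites (F.P K) M j X) α₀ α₁ :=
  ofBackgroundC_UbgMSOfRecord_mem_spaceI_of_classBound S hι hS hcB ν M g K k s W h1 hjk hα₀ hα₁ X hX hBα
    (fun hsol => plaqSmallOn_UbgMSOfRecord_of_thm1Scaled h15 ν M g K k cR s hnum ha₀ hW hsol j hjk) hloc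

/-- **★ `U_k(s)(𝐖) ∈ Ũ^c_j(X, α̃₀, α̃₁)` OF RECORD** (any `X`) FROM `VariationalThm1Scaled B₃ a₀ a₁`, the record's numerics (`0 < cR·ε_n ≤ a₁`, `B₃·cR·ε_n ≤ εreg ≤ a₀`,
and `B₃·cR·ε_n ≤ (1 − β)·α₀(g_n)` for `1 ≤ n ≤ j` — §1 from `p₀ ≤ q₀`, `B₃·cR·A₀ ≤ (1 − β)C₀`), positive radii at the scales `≤ j`, and the DISPLAYED (2.38)
layer-cube gauge clause ([15] Thm 1 (9)–(10)). [cite: Balaban1988Convergent, (2.34)–(2.39) p.261; Balaban1985Variational, Thm 1 (8)–(10) p.279] -/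
theorem ofBackgroundC_UbgMSOfRecord_mem_spaceMS_of_thm1Scaled {B₃ a₀ a₁ : ℝ} (h15 : VariationalThm1Scaled F N B₃ a₀ a₁)
    (S : Sect2.Setting (MatA N) (SU N)) (hι : S.ι = ιSU N) (hS : S.Laws) (hpos : S.Pos)
    (ν : Stage7Numerics) (M : ℕ) (K k : ℕ) (cR : ℝ) (s : SeqOfRecord F ν M S.flow.g K k)
    (hnum : ∀ n, n ≤ k → 0 < cR * epsOfRecord ν S.flow.g n ∧ cR * epsOfRecord ν S.flow.g n ≤ a₁ ∧ B₃ * (cR * epsOfRecord ν S.flow.g n) ≤ ν.εreg)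
    (ha₀ : ν.εreg ≤ a₀) {j : ℕ} (hjk : j ≤ k)
    (hα : ∀ n, 1 ≤ n → n ≤ j → 0 < S.lf.alpha0 (S.flow.g n) ∧ 0 < S.lf.alpha1 (S.flow.g n))
    (hBα : ∀ n, 1 ≤ n → n ≤ j → B₃ * (cR * epsOfRecord ν S.flow.g n) ≤ (1 - S.βc) * S.lf.alpha0 (S.flow.g n))
    {W : MSField (F.P K) (SU N)} (hW : W ∈ regSuppOfRecord F N ν M S.flow.g K k cR s)
    (X : (Sect2.domSys (F.P K) M j).Dom)
    (h238 : W ∈ solvableDom (avOfRecord F N K) (regMSOfRecord F N ν K k s.Ω) (genSet s.Ω k) →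
      CondII238 S.𝓜 (Sect2.frameMS (Sect2.Residual.unit (F.P K) (MatA N)) M j (Sect2.domSites (F.P K) M j X) s.Ω)
        (MSConsts.ofParams (F.P K) S.βc S.B S.C S.Mr j) (fun n => S.lf.alpha0 (S.flow.g n)) (fun b' => S.ι (UbgMSOfRecord F N ν M S.flow.g K k s W b'))) :
    Sect2.ofBackgroundC S.ι (UbgMSOfRecord F N ν M S.flow.g K k s W) ∈
      Sect2.spaceMS S (Sect2.Residual.unit (F.P K) (MatA N)) M j (Sect2.domSites (F.P K) M j X) s.Ω :=
  ofBackgroundC_UbgMSOfRecord_mem_spaceMS_of_classBound S hι hS hpos ν M K k s W hα X hBα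
    (fun hsol n _ hn => plaqSmallOn_UbgMSOfRecord_of_thm1Scaled h15 ν M S.flow.g K k cR s hnum ha₀ hW hsol n (hn.trans hjk)) h238

end RangedRow

/-! ## §7  ★ THE RANGED TOKEN `BgProvisoΛ` (node00-def-R FILE 20′) AT DEF-R'S OBJECTS, from [15] Thm 1 (per-scale reading) + numerics + the two gauge clauses -/

section Ranged

variable {F : T4Family} {N : ℕ} [NeZero N]

/-- **★★ ROW P11, RANGED (`BgProvisoΛ`), AT DEF-R'S OBJECTS** — support `regSuppOfRecord … cR`, background `UbgMSOfRecord` (every level `k`; the record's level-`0`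
background `𝐖 ↦ 𝐖₀` has a vacuous row), the `SU(N)` setting `S` along the history `S.flow.g`, K0b's unit residual recipe — FROM: the named fact `VariationalThm1Scaled B₃ a₀ a₁`
([15] Thm 1 (8) in the per-scale reading); the record's numerics against print's constants (`0 < cR·ε_n ≤ a₁`, `B₃·cR·ε_n ≤ εreg ≤ a₀`, `B₃·cR·ε_n ≤ (1 − β)·α₀(g_n)` for
`n ≤ k` — §1 derives the last from `p₀ ≤ q₀`, `B₃·cR·A₀ ≤ (1 − β)·C₀`, `g_n² ≤ e⁻¹`); positive radii at the scales `1 ≤ n ≤ k` (the window); and the two DISPLAYED gauge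
clauses at the minimiser — (1.12) on the cubes of `X ⊂ Λ_j` and (2.38) on the layer cubes of `X` in the (2.41) range — = [15] Thm 1 (9)–(10) on print's cube class,
NOT supplied here.  What the row costs beyond this file: ONE cited regularity theorem (scaled reading) and those two gauge clauses.
[cite: Balaban1988Convergent, (2.27)–(2.28) p.259, (2.34)–(2.41) p.261; Balaban1985Variational, Thm 1 (8)–(10) p.279; Balaban1987RG1, (1.11)–(1.16) p.262] -/
theorem bgProvisoΛ_UbgMSOfRecord_of_thm1Scaled {B₃ a₀ a₁ : ℝ} (h15 : VariationalThm1Scaled F N B₃ a₀ a₁)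
    (S : Sect2.Setting (MatA N) (SU N)) (hι : S.ι = ιSU N) (hS : S.Laws) (hpos : S.Pos)
    (ν : Stage7Numerics) (M : ℕ) (K k : ℕ) (cR : ℝ)
    (hnum : ∀ n, n ≤ k → 0 < cR * epsOfRecord ν S.flow.g n ∧ cR * epsOfRecord ν S.flow.g n ≤ a₁ ∧ B₃ * (cR * epsOfRecord ν S.flow.g n) ≤ ν.εreg)
    (ha₀ : ν.εreg ≤ a₀)
    (hα : ∀ n, 1 ≤ n → n ≤ k → 0 < S.lf.alpha0 (S.flow.g n) ∧ 0 < S.lf.alpha1 (S.flow.g n))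
    (hBα : ∀ n, 1 ≤ n → n ≤ k → B₃ * (cR * epsOfRecord ν S.flow.g n) ≤ (1 - S.βc) * S.lf.alpha0 (S.flow.g n))
    (hloc : ∀ (s : SeqOfRecord F ν M S.flow.g K k) (W : MSField (F.P K) (SU N)), W ∈ regSuppOfRecord F N ν M S.flow.g K k cR s →
      W ∈ solvableDom (avOfRecord F N K) (regMSOfRecord F N ν K k s.Ω) (genSet s.Ω k) →
      ∀ j, 1 ≤ j → j ≤ k → ∀ X : (Sect2.domSys (F.P K) M j).Dom, Sect2.domSites (F.P K) M j X ⊆ s.Λ j →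
      ∀ C ∈ Sect2.cubesI M j (Sect2.domSites (F.P K) M j X), ∃ u : Site (F.P K) 0 → (MatA N)ˣ, (∀ x, u x ∈ S.𝓜.G) ∧ ∃ A : PBond (F.P K) 0 → MatA N,
        (∀ bd ∈ C.bonds, gaugeU u (fun b' => S.ι (UbgMSOfRecord F N ν M S.flow.g K k s W b')) bd = expI ((F.P K).eta j) (A bd)) ∧
        (∀ bd ∈ C.bonds, ‖A bd‖ < S.cB * S.lf.alpha0 (S.flow.g j)) ∧
        ∀ q ∈ C.dpairs, ‖grad ((F.P K).eta j) q.2.1 (fun y => A ⟨y, q.2.2⟩) q.1‖ < S.cB * S.lf.alpha0 (S.flow.g j))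
    (h238 : ∀ (s : SeqOfRecord F ν M S.flow.g K k) (W : MSField (F.P K) (SU N)), W ∈ regSuppOfRecord F N ν M S.flow.g K k cR s →
      W ∈ solvableDom (avOfRecord F N K) (regMSOfRecord F N ν K k s.Ω) (genSet s.Ω k) →
      ∀ j, 1 ≤ j → j ≤ k → ∀ X : (Sect2.domSys (F.P K) M j).Dom, Sect2.admB (F.P K) ν M S.flow.g s.Ω s.Λ j (Sect2.domSites (F.P K) M j X) = true →
      CondII238 S.𝓜 (Sect2.frameMS (Sect2.Residual.unit (F.P K) (MatA N)) M j (Sect2.domSites (F.P K) M j X) s.Ω)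
        (MSConsts.ofParams (F.P K) S.βc S.B S.C S.Mr j) (fun n => S.lf.alpha0 (S.flow.g n)) (fun b' => S.ι (UbgMSOfRecord F N ν M S.flow.g K k s W b'))) :
    BgProvisoΛ F N K S (Sect2.Residual.unit (F.P K) (MatA N)) M k (regSuppOfRecord F N ν M S.flow.g K k cR) (UbgMSOfRecord F N ν M S.flow.g K k) := by
  intro s W hW j h1 hjk X
  have hBα' : B₃ * (cR * epsOfRecord ν S.flow.g j) ≤ S.lf.alpha0 (S.flow.g j) := by
    refine (hBα j h1 hjk).trans ?_
    have h0 := (hα j h1 hjk).1.le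
    nlinarith [hpos.βc_nonneg, h0]
  refine ⟨fun hX => ?_, fun hB => ?_⟩
  · exact ofBackgroundC_UbgMSOfRecord_mem_spaceI_of_thm1Scaled h15 S hι hS hpos.cB_pos ν M S.flow.g K k cR s hnum ha₀ h1 hjk (hα j h1 hjk).1
      (hα j h1 hjk).2 hBα' hW X hX (fun hsol => hloc s W hW hsol j h1 hjk X hX)
  · exact ofBackgroundC_UbgMSOfRecord_mem_spaceMS_of_thm1Scaled h15 S hι hS hpos ν M K k cR s hnum ha₀ hjk (fun n hn hnj => hα n hn (hnj.trans hjk))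
      (fun n hn hnj => hBα n hn (hnj.trans hjk)) hW X (fun hsol => h238 s W hW hsol j h1 hjk X hB)

/-- **THE LETTER INEQUALITY `hBα` FROM THE NUMERICS, along a history in the window** (`0 < g_n`, `g_n² ≤ e⁻¹` for `n ≤ k`): `p₀ ≤ q₀` and `0 ≤ B₃·cR·A₀ ≤ (1 − β)·C₀` give
`B₃·cR·ε_n ≤ (1 − β)·α₀(g_n)` at every scale — «C₀ sufficiently large», (2.28). [cite: Balaban1988Convergent, (2.4) p.255, (2.28) p.259, (2.34) p.261] -/
theorem hBα_of_numerics (lf : Step.LFConsts) (ν : Stage7Numerics) {B₃ cR β : ℝ} {g : ℕ → ℝ} {k : ℕ}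
    (hw : ∀ n, n ≤ k → 0 < g n ∧ g n ^ 2 ≤ Real.exp (-1)) (hpq : ν.p₀ ≤ lf.q₀) (hBc : 0 ≤ B₃ * cR * ν.A₀) (hC : B₃ * cR * ν.A₀ ≤ (1 - β) * lf.C₀) :
    ∀ n, 1 ≤ n → n ≤ k → B₃ * (cR * epsOfRecord ν g n) ≤ (1 - β) * lf.alpha0 (g n) :=
  fun n _ hn => mul_eps_le_mul_alpha0 lf (hw n hn).1.le (one_le_log_inv_sq (hw n hn).1 (hw n hn).2) hpq hBc hC

end Ranged

/-! ## §8 (v1.1, append-only)  PRINT'S SEPARATION OF THE SEQUENCE — the named fact restricted to SEPARATED sequences with COMPARABLE thresholds (the faithful reading) -/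

section Separated

variable (F : T4Family) (N : ℕ) [NeZero N]

/-- **PRINT'S SEPARATION OF AN ADMISSIBLE SEQUENCE** ([6] = [Balaban1985RegularSpaces] (1.3)–(1.6) p. 77, the sequences for which [15]'s variational problem is posed:
«Ω_n is a union of Lⁿξ M₁-cubes … dist(Ω_n, Ωᶜ_{n−1}) ≥ LⁿξM₁»; [III] p. 256: «the distance between their boundaries is at least equal to 2MR_j»), READ on the torus of record
for a (2.18) index `s`: one layer of `L^{n+1}M₁`-cubes around `Ω_{n+1}(s)` stays inside `Ω_n(s)`, `1 ≤ n < k` (`Sect2.enlT`).  r11's `B14Eq218Concrete.Seq` ∕ `Chain21` — the tree's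
(2.18) index — carries ONLY the inclusions `Λ_j ⊆ Ω_j`, `Ω_{j+1} ⊆ Λ_j` (no separation): a LOCATED range difference between the tree's index set and print's admissible sequences;
every row quantified `∀ s : SeqOfRecord …` is print-stronger by exactly this predicate. [cite: Balaban1985RegularSpaces, (1.3)–(1.6) p.77; Balaban1988Convergent, (2.1) p.254, p.256] -/
def Sect2.SeqSeparated {P : Params} (M₁ : ℕ) {D : ℕ → Set (Set (Site P 0))} {k : ℕ} (s : B14.Eq218Concrete.Seq D k) : Prop :=
  ∀ n, 1 ≤ n → n < k → Sect2.enlT P (B14.Eq213MaximalDomains.side P.L M₁ (n + 1)) 1 (s.Ω (n + 1)) ⊆ s.Ω n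

/-- **[15] THEOREM 1 (8) IN THE PER-SCALE READING, FOR PRINT'S SEQUENCES** — the FAITHFUL form of `VariationalThm1Scaled`: the same statement restricted to SEPARATED
sequences ([6] (1.3)–(1.6), `Sect2.SeqSeparated ν.M₁ s`) and to data thresholds COMPARABLE across consecutive scales (`δ_n ≤ 2δ_{n+1}`, the (2.7)–(2.8) regime of [III]'s
`ε_j = ε(g_j)` along an increasing flow).  WHY BOTH CLAUSES (located): without separation a deep domain `Ω_{n+m}` may touch `Γ_n`, where the scale-`n` data force fine plaquettes
of size `δ_n·η_n² = L^{2m}δ_n·η_{n+m}²` — no constant `B₃(d, L)` bounds that by `B₃δ_{n+m}η_{n+m}²`; with separation but without comparability the interface plaquettes of `Ω_{n+1}`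
are `L²δ_n·η_{n+1}²`, so `B₃ ≥ L²·δ_n∕δ_{n+1}` — print's `B₃` «depends on d and L only» exactly because its sequences are separated and its thresholds comparable.
`VariationalThm1Scaled → VariationalThm1ScaledSep` (below); consumers wanting the faithful hypothesis take this one and supply the two clauses per sequence.
-- TODO(general form): [15] Thm 1 is printed with ONE threshold ε₁; the per-scale form is the reading [III] p. 259 invokes («proper restrictions on ε_j»).
[cite: Balaban1985Variational, Thm 1 (7)–(8) p.279; Balaban1985RegularSpaces, (1.3)–(1.8) p.77; Balaban1988Convergent, (2.7)–(2.8) pp.255–256, (2.12) p.256, p.259] -/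
def VariationalThm1ScaledSep (B₃ a₀ a₁ : ℝ) : Prop :=
  ∀ (ν : Stage7Numerics) (M : ℕ) (g : ℕ → ℝ) (K k : ℕ) (s : SeqOfRecord F ν M g K k), Sect2.SeqSeparated ν.M₁ s → ∀ (ε₀ : ℝ) (δ : ℕ → ℝ),
    (∀ n, n ≤ k → 0 < δ n ∧ δ n ≤ a₁ ∧ B₃ * δ n ≤ ε₀) → (∀ n, n < k → δ n ≤ 2 * δ (n + 1)) → ε₀ ≤ a₀ →
    ∀ W : MSField (F.P K) (SU N), (∀ n, n ≤ k → PlaqSmallOn (B8Eq17ClassAkV1.plaqsOf (genSet s.Ω k n)) (δ n) (W n)) →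
      (∃ U₀, IsMinimizer (avOfRecord F N K) {U | ∀ n, n ≤ k → PlaqSmallOn (omegaPlaqs s.Ω n) (ε₀ * (F.P K).eta n ^ 2) U} (genSet s.Ω k) W U₀) ∧
      ∀ U₀, IsMinimizer (avOfRecord F N K) {U | ∀ n, n ≤ k → PlaqSmallOn (omegaPlaqs s.Ω n) (ε₀ * (F.P K).eta n ^ 2) U} (genSet s.Ω k) W U₀ →
        ∀ n, n ≤ k → PlaqSmallOn (omegaPlaqs s.Ω n) (B₃ * δ n * (F.P K).eta n ^ 2) U₀

variable {F N}

/-- The unrestricted per-scale reading implies the faithful one (it drops two hypotheses). [cite: Balaban1985Variational, Thm 1 (8) p.279 (bookkeeping)] -/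
theorem VariationalThm1Scaled.toScaledSep {B₃ a₀ a₁ : ℝ} (h : VariationalThm1Scaled F N B₃ a₀ a₁) : VariationalThm1ScaledSep F N B₃ a₀ a₁ :=
  fun ν M g K k s _ ε₀ δ hδ _ hε₀ W hW => h ν M g K k s ε₀ δ hδ hε₀ W hW

/-- **THE MINIMISER OF RECORD IS `B₃·cR·ε_n`-REGULAR AT EVERY SCALE, along a SEPARATED sequence with COMPARABLE thresholds** — §3's `plaqSmallOn_UbgMSOfRecord_of_thm1Scaled`
from the faithful named fact: the two extra clauses are displayed per sequence (`hsep`) and per run (`hcomp : cR·ε_n ≤ 2·cR·ε_{n+1}` — holds along an increasing history in the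
window `γ ≤ ½`). [cite: Balaban1985Variational, Thm 1 (8) p.279; Balaban1988Convergent, (2.7)–(2.8) pp.255–256, (2.12) p.256] -/
theorem plaqSmallOn_UbgMSOfRecord_of_thm1ScaledSep {B₃ a₀ a₁ : ℝ} (h15 : VariationalThm1ScaledSep F N B₃ a₀ a₁) (ν : Stage7Numerics) (M : ℕ)
    (g : ℕ → ℝ) (K k : ℕ) (cR : ℝ) (s : SeqOfRecord F ν M g K k) (hsep : Sect2.SeqSeparated ν.M₁ s)
    (hnum : ∀ n, n ≤ k → 0 < cR * epsOfRecord ν g n ∧ cR * epsOfRecord ν g n ≤ a₁ ∧ B₃ * (cR * epsOfRecord ν g n) ≤ ν.εreg) (ha₀ : ν.εreg ≤ a₀)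
    (hcomp : ∀ n, n < k → cR * epsOfRecord ν g n ≤ 2 * (cR * epsOfRecord ν g (n + 1)))
    {W : MSField (F.P K) (SU N)} (hW : W ∈ regSuppOfRecord F N ν M g K k cR s)
    (hsol : W ∈ solvableDom (avOfRecord F N K) (regMSOfRecord F N ν K k s.Ω) (genSet s.Ω k)) :
    ∀ n, n ≤ k → PlaqSmallOn (omegaPlaqs s.Ω n) (B₃ * (cR * epsOfRecord ν g n) * (F.P K).eta n ^ 2) (UbgMSOfRecord F N ν M g K k s W) :=
  (h15 ν M g K k s hsep ν.εreg (fun n => cR * epsOfRecord ν g n) hnum hcomp ha₀ W hW).2 _ (isMinimizer_UbgMSOfRecord ν M g K k s hsol)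

end Separated

end Literature.MathematicalPhysics.QuantumFieldTheory.Balaban1983to89.Node00

end
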